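import Summits.QuantumFields.YangMills.Theorems.BalabanUVNodesN07JOfRecordGaugeCovariance
import Literature.MathematicalPhysics.QuantumFieldTheory.Balaban1983to89.Node00.BackgroundCurrentCompare
import HarnessLib

/-!
# NODE N07 — THE T-J GLUE OF THE (τ) ROW: [B11] (2)'s TYPED CLASS AT THE RECORD (`Node00.InUkClassB11`, the currency of Thm 1 (8)) ⟹ lit's
# (14)-CURRENT CLAUSE `InU2cur … (unitsOfRecord F N U₀)` ⟹ (28) `‖J(U₀)‖₍₋₃₎ ≤ ε₀` FOR def-Y's `Node00.JOfRecordAtBg`; WITH THE CARRIER BRIDGE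
# `torusT ∕ cfgGL` (B10∕B12 letters on `Site`∕`PBond`) = `Tsh ∕ Ucur ∘ unitsOfRecord` (lit letters on `TSite`∕`Bond`) AND `currentOfRecord = π ∘ J` OF RECORD

Cell `pub-ymgap`, width seat `pub-ymgap-dag-n07-w3` (g25), INTENT-2 ∕ CLAIM-2.  `--kind proof --supports stmt-QuantumFields-27238 --as helper`; count-neutral.
[15] = [Balaban1985Variational]; [B9] = [Balaban1985BackgroundPropagators]; [I] = [Balaban1987RG1]; [B8] = [Balaban1985RegularSpaces].

WHY.  def-Y's M2 file 3d′ (✓`Node00/BgCurrentOfRecord`) states (28) at the record, `‖JOfRecordAtBg F N K k Ω U₀‖ ≤ C₁B₃ε₁`, under the DISPLAYED hypothesis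
`B11Prop6Concrete.InU2cur (F.L) (η_k) (bondLevLit F Ω k) (C₁B₃ε₁) (unitsOfRecord F N U₀)` and names the derivation of that clause from «(14)-of-record» the
cell's N07 ∕ porter glue (M2-PLAN §2e, token T-J).  The typed (14)∕(2)-class at the record EXISTS: n01-b's ✓`Node00.InUkClassB11 F N K k ε₀ U`
(`Node00/BackgroundCurrentShape` §4 = `B10Eq68TorusRegularity.InSpace` at `Ω_j = T`, `η = η_k`; `inUkClassB11_iff : … ↔ U ∈ bgReg ∧ RegDivAt k univ ε₀ η_k (cfgGL N U)`)
— it is the currency in which the N07 lane's Prop 8 ∕ Thm 1 (8) texts conclude (✓`…N07ExistenceFromProp8AtRadius`: `… → InUkClassB11 F N i.K i.k (ζ.B₃ * ε₁) U`)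
and in which GAPS G₈a-3's (8)-form home `Node00.UkInSpaceB11` is typed.  Its divergence clause reads `B10Eq68TorusRegularity.covDivT` on the record's own
`Site`∕`PBond` carriers, while `InU2cur` reads r08's `B9Eq39Adjoint.divPη … (plaqField …)` on lit's `TSite`∕`Bond` carriers through `Node00.siteToLit`∕`bondToLit`:
n01-b's ✓`Node00.covDivT_eq_divPη` identifies the two OPERATORS on the record's carrier (`torusT`, `dirForm (cfgGL N U)`); what is missing is the transport of
r08's letters along the site equivalence `siteToLit` (which intertwines the shifts, ✓`siteToLit_shift`) — §1–§2 here (also def-Y's owed comparison lemmas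
«`Tsh∕siteToLit` versus `torusT`» and «`JOfRecordAtBg (bondToLit b)` = `currentOfRecord … b` up to `π`»).  §3 is the glue itself.

WHAT IS PROVED (sorry-free; no definition; axioms standard).
* §1 (generic REINDEXING of r08's letters along `e : S ≃ S′` with `e (T μ x) = T′ μ (e x)` and `U′ μ (e x) = U μ x`): `symm_reindex`, `covDstar_reindex`,
  `plaqU_reindex`, `plaqField_reindex`, `divP_reindex`, `divPη_plaqField_reindex`, `J_reindex` (`J_{T′,U′}(μ, e x) = J_{T,U}(μ, x)`).
* §2 (THE RECORD BRIDGE): `cfgGL_eq_suToUnits`, `siteToLit_torusT` (`siteToLit (torusT μ x) = Tsh μ (siteToLit x)`), `ucur_unitsOfRecord_siteToLit`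
  (`Ucur (unitsOfRecord F N U₀) μ (siteToLit x) = dirForm (cfgGL N U₀) μ x`), ★ `divPη_plaqField_unitsOfRecord_bondToLit`, ★★ `covDivT_cfgGL_eq_divPη_unitsOfRecord`
  (B10's (14)-current of the record = lit's `D^{η*}_U∂U` at `bondToLit b`), ★ `J_cfgGL_eq_JOfRecordAtBg_apply` (r08's `J` on the record's torus datum = def-Y's letter read
  at `bondToLit b`), ★★ `currentOfRecord_eq_slProj_JOfRecordAtBg` ([I] (1.2)'s current of record = `π` of def-Y's letter, `π = slProj N`), and at `N = 2`:
  ★ `currentOfRecord_two_eq_JOfRecordAtBg` (EQUAL — `π` is the identity on the traceless `J(b)`, ✓p818308 `trace_JOfRecordAtBg_apply_two`).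
* §3 (THE GLUE): ★★★ `inU2cur_unitsOfRecord_of_inUkClassB11` (`0 ≤ ε₀ → InUkClassB11 F N K k ε₀ U₀ → (∀ a, lev a ≤ k) → InU2cur (F.L) (η_k) lev ε₀ (unitsOfRecord F N U₀)`;
  every level map bounded by `k`, in particular `bondLevLit F Ω k` for EVERY `Ω`: `inU2cur_unitsOfRecord_bondLevLit_of_inUkClassB11`), ★★★ `norm_JOfRecordAtBg_le_of_inUkClassB11`
  (**(28) AT THE RECORD FROM THE CLASS: `‖J(U₀)‖₍₋₃₎ ≤ ε₀`**), `norm_JOfRecordAtBg_gaugeAct_le_of_inUkClassB11` (along the orbit), ★★ `norm_JOfRecordAtBg_Uk_le_of_ukInSpaceB11`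
  (at the minimiser OF RECORD `Uk F N K k ε V` under G₈a-3's typed (8)-form `UkInSpaceB11 F N K k ε ε₀`: T-J of the (τ) row is [B11] Thm 1 (8) BY NAME), and
  `inU2cur_unitsOfRecord_Uk_of_ukInSpaceB11`.

HONEST SCOPE.  GLUE ONLY: (28) ∕ T-J becomes a theorem MODULO the displayed class membership `InUkClassB11 … ε₀ U₀` ([15] Thm 1 (8) for the minimiser — the N07 node's
content, typed as `Node00.UkInSpaceB11`, proved NOWHERE); the converse bridge from [I] (1.2)'s `π Im`-current clause (`Node00.InUkClass`) is NOT available (π Im forgets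
the trace and the real part; n01-b's honest scope) and is not claimed; no estimate of the series is proved or used; P0 ⟨26900⟩ OPEN; K0ᴬ∕K1ᴬ∕K3ᴬ OPEN; N07 NOT
discharged; COUNT 8∕28 · K 1∕4 UNMOVED; finite `𝕋⁴` at fixed `ε` — R4 closes only the conditional finite-𝕋⁴ rung `BalabanLadder.UV`, never the summit; nothing
continuum ∕ ℝ⁴ ∕ OS; the Yang–Mills mass gap (Clay) is NOT proved by any of this.  No `sorry`, no `def`, no `instance`, no `notation`.

References: [15] (2) p. 278, (8) p. 279, (14) p. 280, (27)–(28) p. 282; [B9] (3.1)–(3.11) pp. 390–392; [I] (1.2) p. 260, (1.8) p. 261; [B8] (1.2), (1.9) pp. 76–77.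
-/

set_option autoImplicit false

noncomputable section

open scoped Matrix.Norms.L2Operator InnerProductSpace ComplexConjugate Matrix

namespace Summit.QuantumFields.YangMills.Theorems.N07JOfRecordBoundOfThm1Class

open Literature.MathematicalPhysics.QuantumFieldTheory.Balaban1983to89
open Literature.MathematicalPhysics.QuantumFieldTheory.Balaban1983to89.T4Continuum (T4Family)
open T4Continuum
open B4Sect5Torus (TSite)
open B9SectCLatticeCarrier (Bond bpos btgt)
open B9Eq39Adjoint (R R_def covDstar plaqU divP divPη J)
open B9Eq37Insertion (imC)
open B11Eq27Current (plaqField imPart)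
open B11Eq90V0primeCurrent (Tsh Ucur)
open B11Eq115Space (NegSup levWeight levWeight_pos levWeight_apply)
open B11Prop6Concrete (InU2cur)
open B9TorusCalculus (torusT torusT_apply)
open B12Eq18Current (dirForm dirForm_apply)
open B10Eq68TorusRegularity (covDivT RegDivAt BTouches)
open B12Lemma4Models (slProj slProj_conj slProj_of_trace_eq_zero)
open Node00
open Summit.QuantumFields.YangMills.Theorems.N07JOfRecordGaugeCovariance (norm_JOfRecordAtBg_gaugeAct trace_JOfRecordAtBg_apply_two)
open GaugeField (gaugeAct)

/-! ## §1  Generic: reindexing r08's letters along a site equivalence intertwining the shifts -/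

section Reindex

variable {𝔸 : Type*} [Ring 𝔸] {S S' ι : Type*} (e : S ≃ S') (T : ι → Equiv.Perm S) (T' : ι → Equiv.Perm S')
  (U : ι → S → 𝔸ˣ) (U' : ι → S' → 𝔸ˣ)
  (hT : ∀ (μ : ι) (x : S), e (T μ x) = T' μ (e x)) (hU : ∀ (μ : ι) (x : S), U' μ (e x) = U μ x)

include hT in
/-- The backward steps are intertwined too: `T′_μ⁻¹ (e x) = e (T_μ⁻¹ x)`. [folklore] [cite: Balaban1985BackgroundPropagators, (3.5) p.391] -/
theorem symm_reindex (μ : ι) (x : S) : (T' μ).symm (e x) = e ((T μ).symm x) := by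
  apply (T' μ).injective
  rw [Equiv.apply_symm_apply, ← hT, Equiv.apply_symm_apply]

include hT hU in
/-- `D*_μ` commutes with reindexing: `(D*_{U′,μ} (G ∘ e⁻¹))(e x) = (D*_{U,μ} G)(x)`. [folklore] [cite: Balaban1985BackgroundPropagators, (3.8) p.392] -/
theorem covDstar_reindex (μ : ι) (G : S → 𝔸) (x : S) : covDstar T' U' μ (G ∘ e.symm) (e x) = covDstar T U μ G x := by
  simp only [covDstar, symm_reindex e T T' hT, Function.comp_apply, Equiv.symm_apply_apply, hU]

include hT hU in
/-- The plaquette variable commutes with reindexing: `U′(∂p_{μν}(e x)) = U(∂p_{μν}(x))`. [folklore] [cite: Balaban1985BackgroundPropagators, (3.1) p.390] -/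
theorem plaqU_reindex (μ ν : ι) (x : S) : plaqU T' U' μ ν (e x) = plaqU T U μ ν x := by
  simp only [plaqU, ← hT, hU]

include hT hU in
/-- The plaquette field commutes with reindexing. [folklore] [cite: Balaban1985Variational, (28) p.282] -/
theorem plaqField_reindex (μ ν : ι) (x : S) : plaqField T' U' μ ν (e x) = plaqField T U μ ν x := by
  simp only [plaqField, plaqU_reindex e T T' U U' hT hU]

variable [Fintype ι] [LinearOrder ι]

include hT hU in
/-- `D*` on plaquette functions commutes with reindexing: for `Φ′_{κν}(e y) = Φ_{κν}(y)`, `(D*_{U′}Φ′)_μ(e x) = (D*_U Φ)_μ(x)`. [folklore]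
[cite: Balaban1985BackgroundPropagators, (3.9) p.392] -/
theorem divP_reindex (Φ : ι → ι → S → 𝔸) (Φ' : ι → ι → S' → 𝔸) (hΦ : ∀ (κ ν : ι) (y : S), Φ' κ ν (e y) = Φ κ ν y) (μ : ι) (x : S) :
    divP T' U' Φ' μ (e x) = divP T U Φ μ x := by
  have hΦ' : ∀ κ ν, Φ' κ ν = Φ κ ν ∘ e.symm := fun κ ν => by
    funext z
    rw [Function.comp_apply, ← hΦ κ ν (e.symm z), Equiv.apply_symm_apply]
  simp only [divP, hΦ', covDstar_reindex e T T' U U' hT hU]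

variable [Algebra ℂ 𝔸]

include hT hU in
/-- **THE (14)-CURRENT COMMUTES WITH REINDEXING**: `(D^{η*}_{U′}∂U′)_μ(e x) = (D^{η*}_U ∂U)_μ(x)`. [folklore] [cite: Balaban1985Variational, (2) p.278, (14) p.280] -/
theorem divPη_plaqField_reindex (η : ℝ) (μ : ι) (x : S) :
    divPη T' U' η (plaqField T' U') μ (e x) = divPη T U η (plaqField T U) μ x := by
  simp only [divPη]
  rw [divP_reindex e T T' U U' hT hU (plaqField T U) (plaqField T' U') (plaqField_reindex e T T' U U' hT hU)]

include hT hU in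
/-- **THE CURRENT COMMUTES WITH REINDEXING**: `J_{T′,U′}(μ, e x) = J_{T,U}(μ, x)` ((3.11) is built from `D*`, `Im`, `U(∂p)` only). [folklore]
[cite: Balaban1985BackgroundPropagators, (3.11) p.392; Balaban1985Variational, (27)–(28) p.282] -/
theorem J_reindex (η : ℝ) (μ : ι) (x : S) : J T' U' η μ (e x) = J T U η μ x := by
  simp only [J, divPη]
  rw [divP_reindex e T T' U U' hT hU (fun κ ν y => (((η : ℂ)⁻¹) ^ 2) • imC (plaqU T U κ ν y))
    (fun κ ν y => (((η : ℂ)⁻¹) ^ 2) • imC (plaqU T' U' κ ν y)) (fun κ ν y => by rw [plaqU_reindex e T T' U U' hT hU])]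

end Reindex

/-! ## §2  The record bridge: `torusT ∕ dirForm (cfgGL N U₀)` on `Site` versus `Tsh ∕ Ucur (unitsOfRecord F N U₀)` on lit's `TSite` -/

section Bridge

variable (F : T4Family) (N : ℕ) {K : ℕ} (k : ℕ) (Ω : ℕ → Set (Site (F.P K) 0)) (U₀ : GaugeField (F.P K) 0 (SU N))

/-- The two unit-valued readings of a link variable agree (same underlying matrix). [cite: Balaban1987RG1, (1.10) p.262 (dictionary)] -/
theorem cfgGL_eq_suToUnits (b : PBond (F.P K) 0) : cfgGL N U₀ b = suToUnits N (U₀ b) := Units.ext rfl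

/-- **`siteToLit` INTERTWINES THE SHIFTS**: the record's `torusT μ` (`Site.shift`) is lit's `Tsh μ` (`shift μ`) under the bridge (n01∕def-Y's ✓`siteToLit_shift`).
[cite: Balaban1985BackgroundPropagators, (3.3) p.390] -/
theorem siteToLit_torusT (μ : Fin (F.P K).d) (x : Site (F.P K) 0) :
    siteToLit (F.P K) 0 (torusT (F.P K) 0 μ x) = (Tsh μ) (siteToLit (F.P K) 0 x) := by
  rw [torusT_apply, siteToLit_shift]
  rfl

/-- **THE TRANSPORTERS AGREE UNDER THE BRIDGE**: `Ucur (unitsOfRecord F N U₀) μ (siteToLit x) = dirForm (cfgGL N U₀) μ x` (both are the link `U₀⟨x, μ⟩`).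
[cite: Balaban1985BackgroundPropagators, (3.1) p.390] -/
theorem ucur_unitsOfRecord_siteToLit (μ : Fin (F.P K).d) (x : Site (F.P K) 0) :
    Ucur (unitsOfRecord F N U₀) μ (siteToLit (F.P K) 0 x) = dirForm (cfgGL N U₀) μ x := by
  rw [dirForm_apply, cfgGL_eq_suToUnits]
  exact unitsOfRecord_bondToLit U₀ ⟨x, μ⟩

/-- ★ **lit's `D^{η*}_U∂U` at `bondToLit b` IS r08's `D^{η*}_U∂U` on the record's torus datum at `b`** (§1 reindexing along `siteToLit`).
[cite: Balaban1985Variational, (2) p.278, (14) p.280] -/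
theorem divPη_plaqField_unitsOfRecord_bondToLit (η : ℝ) (b : PBond (F.P K) 0) :
    divPη Tsh (Ucur (unitsOfRecord F N U₀)) η (plaqField Tsh (Ucur (unitsOfRecord F N U₀))) (bondToLit (F.P K) 0 b).2 (bondToLit (F.P K) 0 b).1
      = divPη (torusT (F.P K) 0) (dirForm (cfgGL N U₀)) η (plaqField (torusT (F.P K) 0) (dirForm (cfgGL N U₀))) b.dir b.src :=
  divPη_plaqField_reindex (siteToLit (F.P K) 0) (torusT (F.P K) 0) Tsh (dirForm (cfgGL N U₀)) (Ucur (unitsOfRecord F N U₀))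
    (siteToLit_torusT F) (ucur_unitsOfRecord_siteToLit F N U₀) η b.dir b.src

/-- ★★ **THE (14)-CURRENT OF THE RECORD IN BOTH CURRENCIES**: `B10Eq68TorusRegularity.covDivT η (cfgGL N U₀) b.dir b.src` (the quantity of [15] (2)'s divergence clause as
typed in `Node00.InUkClassB11`) EQUALS lit's `divPη Tsh (Ucur (unitsOfRecord F N U₀)) η (plaqField …)` at `bondToLit b` (the quantity of `B11Prop6Concrete.InU2cur`) — n01-b's
✓`covDivT_eq_divPη` + §1. (def-Y's owed comparison «`Tsh∕siteToLit` versus `torusT`».) [cite: Balaban1985Variational, (2) p.278, (14) p.280; Balaban1985RegularSpaces, (1.2) p.76] -/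
theorem covDivT_cfgGL_eq_divPη_unitsOfRecord (η : ℝ) (b : PBond (F.P K) 0) :
    covDivT η (cfgGL N U₀) b.dir b.src
      = divPη Tsh (Ucur (unitsOfRecord F N U₀)) η (plaqField Tsh (Ucur (unitsOfRecord F N U₀))) (bondToLit (F.P K) 0 b).2 (bondToLit (F.P K) 0 b).1 := by
  rw [covDivT_eq_divPη, divPη_plaqField_unitsOfRecord_bondToLit]

/-- ★ **r08's current on the record's torus datum IS def-Y's letter read at `bondToLit b`**: `J (torusT) (dirForm (cfgGL N U₀)) η_k b.dir b.src = J(U₀)(bondToLit b)`.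
[cite: Balaban1985Variational, (27)–(28) p.282; Balaban1985BackgroundPropagators, (3.11) p.392] -/
theorem J_cfgGL_eq_JOfRecordAtBg_apply [Fact (0 < (F.L : ℝ))] [Fact (0 < (F.P K).eta k)] (Ω : ℕ → Set (Site (F.P K) 0)) (b : PBond (F.P K) 0) :
    J (torusT (F.P K) 0) (dirForm (cfgGL N U₀)) ((F.P K).eta k) b.dir b.src
      = NegSup.equiv (levWeight (F.L : ℝ) ((F.P K).eta k) (bondLevLit F Ω k) 3) (Matrix (Fin N) (Fin N) ℂ) (JOfRecordAtBg F N K k Ω U₀) (bondToLit (F.P K) 0 b) := by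
  rw [JOfRecordAtBg_apply]
  exact (J_reindex (siteToLit (F.P K) 0) (torusT (F.P K) 0) Tsh (dirForm (cfgGL N U₀)) (Ucur (unitsOfRecord F N U₀))
    (siteToLit_torusT F) (ucur_unitsOfRecord_siteToLit F N U₀) ((F.P K).eta k) b.dir b.src).symm

/-- ★★ **[I] (1.2)'s CURRENT OF RECORD IS `π` OF def-Y's LETTER**: `Node00.currentOfRecord F N K k U₀ b = slProj N (J(U₀)(bondToLit b))` (`π = slProj N`, the traceless part;
n01-b's ✓`current_eq_proj_J` + §2).  (def-Y's owed comparison «`JOfRecordAtBg (bondToLit b)` vs `currentOfRecord … b` up to `π`».)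
[cite: Balaban1987RG1, (1.2) p.260, (1.8) p.261; Balaban1985Variational, (28) p.282] -/
theorem currentOfRecord_eq_slProj_JOfRecordAtBg [Fact (0 < (F.L : ℝ))] [Fact (0 < (F.P K).eta k)] (b : PBond (F.P K) 0) :
    currentOfRecord F N K k U₀ b
      = slProj N (NegSup.equiv (levWeight (F.L : ℝ) ((F.P K).eta k) (bondLevLit F Ω k) 3) (Matrix (Fin N) (Fin N) ℂ) (JOfRecordAtBg F N K k Ω U₀) (bondToLit (F.P K) 0 b)) := by
  rw [currentOfRecord, current_eq_proj_J (slProj N) (fun g X => slProj_conj g X), J_cfgGL_eq_JOfRecordAtBg_apply]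

/-- ★ **AT THE RECORD `N = 2` THE TWO CURRENTS ARE EQUAL**: `currentOfRecord F 2 K k U₀ b = J(U₀)(bondToLit b)` — `π` is the identity on the traceless `J(b)`
(✓p818308 `trace_JOfRecordAtBg_apply_two`). [cite: Balaban1987RG1, (1.2) p.260; Balaban1985Variational, (28) p.282] -/
theorem currentOfRecord_two_eq_JOfRecordAtBg [Fact (0 < (F.L : ℝ))] [Fact (0 < (F.P K).eta k)] (U₀ : GaugeField (F.P K) 0 (SU 2)) (b : PBond (F.P K) 0) :
    currentOfRecord F 2 K k U₀ b
      = NegSup.equiv (levWeight (F.L : ℝ) ((F.P K).eta k) (bondLevLit F Ω k) 3) (Matrix (Fin 2) (Fin 2) ℂ) (JOfRecordAtBg F 2 K k Ω U₀) (bondToLit (F.P K) 0 b) := by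
  rw [currentOfRecord_eq_slProj_JOfRecordAtBg, slProj_of_trace_eq_zero (trace_JOfRecordAtBg_apply_two F k Ω U₀ _)]

end Bridge

/-! ## §3  The glue: `InUkClassB11 ⟹ InU2cur ⟹ (28)` at the record, for every level map bounded by `k` -/

section Glue

variable (F : T4Family) (N : ℕ) [NeZero N] {K : ℕ} (k : ℕ) (Ω : ℕ → Set (Site (F.P K) 0)) (U₀ : GaugeField (F.P K) 0 (SU N))

/-- The (14)-weights at levels `≤ k` are at most the top weight: `(L^{lev a} η_k)⁻¹ ≥ 1` (since `L^{lev a} η_k = L^{lev a − k} ≤ 1`, `L ≥ 1`).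
[cite: Balaban1985Variational, (2) p.278 (bookkeeping)] -/
theorem one_le_inv_levWeight {lev : Bond (F.P K).d (fun _ => (F.P K).sitesPerDir 0) → ℕ} (hlev : ∀ a, lev a ≤ k)
    (a : Bond (F.P K).d (fun _ => (F.P K).sitesPerDir 0)) : 1 ≤ (levWeight (F.L : ℝ) ((F.P K).eta k) lev 1 a)⁻¹ := by
  have hL : (1 : ℝ) ≤ (F.L : ℝ) := by exact_mod_cast F.hL.2.le
  have hLpos : (0 : ℝ) < (F.L : ℝ) := by linarith
  rw [levWeight_apply, pow_one, Params.eta, T4Family.P_L, inv_pow]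
  have hw : (F.L : ℝ) ^ lev a * ((F.L : ℝ) ^ k)⁻¹ ≤ 1 := by
    rw [mul_inv_le_iff₀ (pow_pos hLpos k), one_mul]
    exact pow_le_pow_right₀ hL (hlev a)
  have hwpos : 0 < (F.L : ℝ) ^ lev a * ((F.L : ℝ) ^ k)⁻¹ := by positivity
  exact (one_le_inv₀ hwpos).2 hw

/-- ★★★ **THE T-J GLUE: [15] (2)'s CLASS AT THE RECORD ⟹ lit's (14)-CURRENT CLAUSE FOR def-Y's TRANSPORTERS**, for every level map bounded by `k`:
`InUkClassB11 F N K k ε₀ U₀ → InU2cur (F.L) (η_k) lev ε₀ (unitsOfRecord F N U₀)` (the scale-`k` divergence clause at `Ω_k = T` gives `‖(D^{η*}∂U₀)(b)‖ < ε₀η_k²`, and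
`ε₀η_k² ≤ ε₀η_k²(L^{lev b}η_k)⁻³`). [cite: Balaban1985Variational, (2) p.278, (14) p.280, (28) p.282] -/
theorem inU2cur_unitsOfRecord_of_inUkClassB11 {ε₀ : ℝ} (hε : 0 ≤ ε₀) (h : InUkClassB11 F N K k ε₀ U₀)
    {lev : Bond (F.P K).d (fun _ => (F.P K).sitesPerDir 0) → ℕ} (hlev : ∀ a, lev a ≤ k) :
    InU2cur (F.L : ℝ) ((F.P K).eta k) lev ε₀ (unitsOfRecord F N U₀) := by
  intro a
  obtain ⟨b, rfl⟩ : ∃ b : PBond (F.P K) 0, bondToLit (F.P K) 0 b = a := ⟨(bondToLit (F.P K) 0).symm a, Equiv.apply_symm_apply _ _⟩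
  have hdiv := ((inUkClassB11_iff hε U₀).1 h).2
  have hb : BTouches (Set.univ : Set (Site (F.P K) 0)) b := Or.inl (Set.mem_univ _)
  have hlt := hdiv.lt hb
  rw [covDivT_cfgGL_eq_divPη_unitsOfRecord, inv_pow_sq_eq_eta_sq] at hlt
  have hη : (0 : ℝ) < (F.P K).eta k := pow_pos (inv_pos.mpr (Nat.cast_pos.mpr (F.P K).L_pos)) k
  have hLη : ((F.P K).L : ℝ) ^ k * (F.P K).eta k = 1 := by
    rw [Params.eta, inv_pow, mul_inv_cancel₀ (pow_ne_zero k (Nat.cast_pos.mpr (F.P K).L_pos).ne')]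
  rw [hLη, inv_one, mul_one] at hlt
  have hw := one_le_inv_levWeight F k hlev (bondToLit (F.P K) 0 b)
  have hε' : 0 ≤ ε₀ * (F.P K).eta k ^ 2 := by positivity
  calc ‖divPη Tsh (Ucur (unitsOfRecord F N U₀)) ((F.P K).eta k) (plaqField Tsh (Ucur (unitsOfRecord F N U₀)))
          (bondToLit (F.P K) 0 b).2 (bondToLit (F.P K) 0 b).1‖
      ≤ ε₀ * (F.P K).eta k ^ 2 := hlt.le
    _ = ε₀ * (F.P K).eta k ^ 2 * 1 := (mul_one _).symm
    _ ≤ ε₀ * (F.P K).eta k ^ 2 * (levWeight (F.L : ℝ) ((F.P K).eta k) lev 1 (bondToLit (F.P K) 0 b))⁻¹ ^ 3 :=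
        mul_le_mul_of_nonneg_left (one_le_pow₀ hw) hε'

/-- The glue at the levels of ANY domain sequence `Ω` (`bondLevLit F Ω k ≤ k`, def-Y's ✓`bondLevLit_le`). [cite: Balaban1985Variational, (14) p.280, p.286] -/
theorem inU2cur_unitsOfRecord_bondLevLit_of_inUkClassB11 {ε₀ : ℝ} (hε : 0 ≤ ε₀) (h : InUkClassB11 F N K k ε₀ U₀) :
    InU2cur (F.L : ℝ) ((F.P K).eta k) (bondLevLit F Ω k) ε₀ (unitsOfRecord F N U₀) :=
  inU2cur_unitsOfRecord_of_inUkClassB11 F N k U₀ hε h (bondLevLit_le Ω k)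

/-- ★★★ **(28) AT THE RECORD FROM [15] (2)'s CLASS**: `InUkClassB11 F N K k ε₀ U₀ → ‖J(U₀)‖₍₋₃₎ ≤ ε₀` for def-Y's `JOfRecordAtBg F N K k Ω U₀`, every `Ω` — the (τ)-row
token T-J is [15] Thm 1 (8) at the record BY NAME (def-Y's ✓`norm_JOfRecordAtBg_le` with its displayed hypothesis discharged by §3's glue).
[cite: Balaban1985Variational, (28) p.282, (8) p.279, (14) p.280] -/
theorem norm_JOfRecordAtBg_le_of_inUkClassB11 [Fact (0 < (F.L : ℝ))] [Fact (0 < (F.P K).eta k)] {ε₀ : ℝ} (hε : 0 ≤ ε₀)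
    (h : InUkClassB11 F N K k ε₀ U₀) : ‖JOfRecordAtBg F N K k Ω U₀‖ ≤ ε₀ := by
  have h14 := inU2cur_unitsOfRecord_bondLevLit_of_inUkClassB11 F N k Ω U₀ hε h
  have hK : (0 : ℝ) ≤ 1 * 1 * ε₀ := by simpa using hε
  have h14' : InU2cur (F.L : ℝ) ((F.P K).eta k) (bondLevLit F Ω k) (1 * 1 * ε₀) (unitsOfRecord F N U₀) := by simpa using h14
  simpa using norm_JOfRecordAtBg_le (F := F) (N := N) (K := K) (k := k) (Ω := Ω) (U₀ := U₀) hK h14'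

/-- (28) along the gauge orbit of a class member (the class is gauge invariant, ✓`inUkClassB11_gaugeAct_iff`; or ✓p818308's norm invariance).
[cite: Balaban1985Variational, (28) p.282, p.278] -/
theorem norm_JOfRecordAtBg_gaugeAct_le_of_inUkClassB11 [Fact (0 < (F.L : ℝ))] [Fact (0 < (F.P K).eta k)] {ε₀ : ℝ} (hε : 0 ≤ ε₀)
    (h : InUkClassB11 F N K k ε₀ U₀) (u : GaugeTransf (F.P K) 0 (SU N)) : ‖JOfRecordAtBg F N K k Ω (gaugeAct u U₀)‖ ≤ ε₀ := by
  rw [norm_JOfRecordAtBg_gaugeAct]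
  exact norm_JOfRecordAtBg_le_of_inUkClassB11 F N k Ω U₀ hε h

/-- **THE (14)-CLAUSE AT THE MINIMISER OF RECORD under G₈a-3's typed (8)-form**: `UkInSpaceB11 F N K k ε ε₀` ⟹ for every solvable `V`,
`InU2cur (F.L) (η_k) (bondLevLit F Ω k) ε₀ (unitsOfRecord F N (Uk F N K k ε V))`. [cite: Balaban1985Variational, Thm 1 (8) p.279, (14) p.280] -/
theorem inU2cur_unitsOfRecord_Uk_of_ukInSpaceB11 {ε ε₀ : ℝ} (hε : 0 ≤ ε₀) (h8 : UkInSpaceB11 F N K k ε ε₀)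
    {V : GaugeField (F.P K) k (SU N)} (hV : UkExists F N K k ε V) :
    InU2cur (F.L : ℝ) ((F.P K).eta k) (bondLevLit F Ω k) ε₀ (unitsOfRecord F N (Uk F N K k ε V)) :=
  inU2cur_unitsOfRecord_bondLevLit_of_inUkClassB11 F N k Ω _ hε (h8 V hV)

/-- ★★ **(28) AT THE MINIMISER OF RECORD — T-J OF THE (τ) ROW IS [15] THM 1 (8) BY NAME**: under G₈a-3's typed home `UkInSpaceB11 F N K k ε ε₀` (the (8)-form of
Thm 1 for `Uk`, proved nowhere — N07's content), `‖J(U_k(V))‖₍₋₃₎ ≤ ε₀` for every solvable `V` and every `Ω`. [cite: Balaban1985Variational, Thm 1 (8) p.279, (28) p.282] -/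
theorem norm_JOfRecordAtBg_Uk_le_of_ukInSpaceB11 [Fact (0 < (F.L : ℝ))] [Fact (0 < (F.P K).eta k)] {ε ε₀ : ℝ} (hε : 0 ≤ ε₀)
    (h8 : UkInSpaceB11 F N K k ε ε₀) {V : GaugeField (F.P K) k (SU N)} (hV : UkExists F N K k ε V) :
    ‖JOfRecordAtBg F N K k Ω (Uk F N K k ε V)‖ ≤ ε₀ :=
  norm_JOfRecordAtBg_le_of_inUkClassB11 F N k Ω _ hε (h8 V hV)

end Glue

end Summit.QuantumFields.YangMills.Theorems.N07JOfRecordBoundOfThm1Class
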